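import Summits.BirchSwinnertonDyer.BirchSwinnertonDyer.Theorems.ByReductionTypeAtTwoOrdKatoHalfAtTwoIsoOmegaRoadDefs
import Summits.BirchSwinnertonDyer.BirchSwinnertonDyer.Theorems.ByReductionTypeAtTwoOrdKatoHalfAtTwoIsoSelmerDualAllPrime
import Literature.NumberTheory.EllipticCurves.NonEisensteinPrimeOfSurjective
import HarnessLib

/-!
# Route ByReductionTypeAtTwo, crux `OrdKatoHalfAtTwoIso` (stmt-BirchSwinnertonDyer-19573), line `steinberg-fibre-at-two`,
# registered stub `stub_T1_selmerSideTwo : SelmerSideTwo` (trunk T1, the Selmer side at `2`) — CLOSED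

Seat `cruxlead-stmt-BirchSwinnertonDyer-19573-g0` (LEAD PROVER, MODE LINE; HOME `run/shared/lean/pub/bsd-2adic/`).
THEOREMS ONLY. HONEST FRAMING (cell bsd-2adic): BSD is not proved by any of this; the crux is not proved; this file
proves the REGISTERED stub `stub_T1_selmerSideTwo` of skeleton v6 (`Cruxes/OrdKatoHalfAtTwoIso/Lines/steinberg_fibre_at_two.lean`),
i.e. the displayed statement `SteinbergFibreAtTwo.SelmerSideTwo` (`Theorems/…OmegaRoadDefs.lean`, p658966), as a
ONE-LINE corollary of the wave-2 worker's ALL-PRIME Selmer side `SelmerDual.stub_selmerDualTwo_holds`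
(`Theorems/…SelmerDualAllPrime.lean`: the odd kernel's `hG1` with `p ≠ 2` removed — its only use was little Fermat —
at `p = 2` with binders `E[2]` irreducible, `κ` cyclotomic, `γ` a topological generator) and Serre's
«`ρ̄₂` onto ⇒ `E[2]` irreducible» (`hasIrreducibleModPGaloisRep_of_hasSurjectiveModNGaloisRep`).

References: R. Greenberg, LNM 1716 (1999) §3 [GreenbergLNM1716]; B. Mazur, K. Rubin, Mem. AMS 799 (2004) §5.3
[MazurRubin2004]; J.-P. Serre, Invent. Math. 15 (1972) §2.4 [Serre1972].
-/

set_option linter.dupNamespace false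
set_option autoImplicit false

noncomputable section

open Literature.NumberTheory.EllipticCurves

namespace Summit.BirchSwinnertonDyer.BirchSwinnertonDyer.Theorems.SteinbergFibreAtTwo

/-- **Registered stub T1 `stub_T1_selmerSideTwo` PROVED: the Selmer side of the core at `p = 2`** (`SelmerSideTwo`:
from a fine class `y ∈ Sel₀(ℚ_∞)[2]`-lift with `T^J y ≠ 0`, a global class `Ψ` of `𝒯_{J+1}(χ⁻¹)` with `T^J Ψ ≠ 0`,
unramified off a finite `S ⊇ S₀`, `T^ε Ψ` locally trivial on `S`), for `ρ̄_{E,2}` onto, `κ` cyclotomic, `γ` a topological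
generator — by `SelmerDual.stub_selmerDualTwo_holds` (all-prime `hG1`, wave 2) and `E[2]` irreducible from `ρ̄₂` onto.
[cite: GreenbergLNM1716, §3 Lemma 3.2] [cite: MazurRubin2004, §5.3] [cite: Serre1972, §2.4 Prop. 15] -/
theorem stub_T1_selmerSideTwo : SelmerSideTwo := by
  intro W _ _ κ γ h2 hκ hγ S₀ hS₀
  haveI : Fact (2 : ℕ).Prime := ⟨Nat.prime_two⟩
  haveI : NeZero ((2 : ℕ) : ℚ) := ⟨by norm_num⟩
  exact Summit.BirchSwinnertonDyer.BirchSwinnertonDyer.Rank1Residual.SelmerDual.stub_selmerDualTwo_holds W κ γ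
    (hasIrreducibleModPGaloisRep_of_hasSurjectiveModNGaloisRep W 2 h2) hκ hγ S₀ hS₀

end Summit.BirchSwinnertonDyer.BirchSwinnertonDyer.Theorems.SteinbergFibreAtTwo

end
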